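import Literature.NumberTheory.Automorphic.ReciprocityGLnDescentProofs
import Literature.NumberTheory.Automorphic.ReciprocityGLnLeavesProofs
import Literature.NumberTheory.GaloisRepresentations.UnramifiedOfTraceLimit
import HarnessLib

/-!
# Sketch (crux-ideate stmt-Langlands-10785, ideator 1, round 1): first lemmas of the two idea cards

Crux decl: `Summit.Langlands.Langlands.Theses.IrreducibilityBySelfDuality.GaloisRepOfRegularAlgebraic`
(= `Literature.NumberTheory.Automorphic.exists_galoisRep_of_regularAlgebraic`, lang.S27).

* §A  card `balanced-place-solvable-descent`: `CompatAtSplitOfUnramifyingLift` — the Galois half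
  of the Henniart–Kim "ramification-lowering base change" transplanted to the Galois side: HLTT
  Thm. A over an extension `L` in which `v` splits completely and above `q_v` the lift `Π` of `π`
  is unramified gives compatibility of `r` with `π` AT `v` (no appeal to Varma's theorem).
* §B  card `pseudocharacter-seam-627`: `HasFrobCharpolyAtOfTraceLimit` and
  `IsUnramifiedAtOfTraceLimitSemisimple` — the two limit lemmas that make the Galois half of
  HLTT Cor. 6.27 formal once the automorphic congruences are granted.

Everything is stated as `Prop`s over existing declarations (nothing is proved here).
-/

noncomputable section

set_option linter.dupNamespace false

open scoped MatrixGroups Matrix Classical Polynomial NumberField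
open NumberField IsDedekindDomain Field Polynomial Filter
open Literature.NumberTheory.Automorphic Literature.NumberTheory.GaloisRepresentations
open Literature.NumberTheory.Automorphic.HarrisLanTaylorThorne2016

namespace Summit.Langlands.Langlands.Cruxes.GaloisRepOfRegularAlgebraic.Sketch

/-! ## §A. Compatibility at a completely split place from an unramifying lift -/

/-- **First lemma of card `balanced-place-solvable-descent` (target theorem, Galois half).**
Let `L/K` be a finite Galois extension of number fields with `L` totally real or CM, `π`, `Π`
regular algebraic cuspidal on `GL_n(𝔸_K)`, `GL_n(𝔸_L)` with the STRONG base-change relation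
`t_{Π,w} = t_{π,v}^{f(w|v)}` at every place `w ∣ v` with `v` unramified in `L` and `π_v`
unramified (the shape of the tree's hypothesis `hBC`), `r : Γ_K → GL_n(ℚ̄_ℓ)` semisimple and
HLTT-compatible with `π` (`IsCompatible`: rational-prime-wise).  If `v ∣ q`, `q ≠ ℓ`, `v` splits
completely in `L` and `Π` is unramified at EVERY place of `L` above `q`, then `r` is compatible
with `π` at `v` (unramified, predicted Frobenius polynomial) — whatever the ramification of `π`
at the other places of `K` above `q`.  Intended proof (all glue in the tree): Thm. A over `L`
gives `r_L` HLTT-compatible with `Π`, hence compatible above `q`; `r|_{Γ_L}` is semisimple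
(`RestrictFieldSemisimple`) and compatible with `Π` almost everywhere
(`isGaloisCompatibleAt_restrictField` + strong relation), so `r|_{Γ_L} ≅ r_L` by Chebotarev and
Brauer–Nesbitt (`nonempty_equiv_of_hasFrobCharpolyAt_eventually` / `theoremA_uniqueness_of_chebotarev`
shape), compatibility transports along the isomorphism (`FramedRep.exists_eq_conj_of_equiv`,
`isGaloisCompatibleAt_conj_iff`) and descends to `K` at the completely split `v`
(`isGaloisCompatibleAt_of_restrictField`, proved). -/
def CompatAtSplitOfUnramifyingLift : Prop :=
  ∀ {n : ℕ} {K L : Type} [Field K] [NumberField K] [Field L] [NumberField L] [Algebra K L]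
    [IsGalois K L] (hK : isCompact_glFiniteIntegralLevel n K) (hL : isCompact_glFiniteIntegralLevel n L),
    (IsTotallyReal L ∨ IsCMField L) →
    ∀ (π : CuspidalAutomorphicRepData n K hK) (PL : CuspidalAutomorphicRepData n L hL),
      π.1.IsRegularAlgebraic → PL.1.IsRegularAlgebraic →
      (∀ (w : HeightOneSpectrum (𝓞 L)) (v : HeightOneSpectrum (𝓞 K)) (α : Multiset ℂ),
          w.asIdeal.under (𝓞 K) = v.asIdeal → Algebra.IsUnramifiedIn (𝓞 L) v.asIdeal →
          π.1.HasSatakeParamAt v α →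
            PL.1.HasSatakeParamAt w (α.map (· ^ w.asIdeal.inertiaDeg (𝓞 K)))) →
      ∀ (ℓ : ℕ) [Fact ℓ.Prime] (ι : PadicAlgCl ℓ ≃+* ℂ) (r : FramedGaloisRep K (PadicAlgCl ℓ) n),
        r.toGaloisRep.IsSemisimple → IsCompatible π.1 ι r →
        ∀ (v : HeightOneSpectrum (𝓞 K)) (q : ℕ), q.Prime → q ≠ ℓ → ((q : ℕ) : 𝓞 K) ∈ v.asIdeal →
          v.asIdeal.ramificationIdxIn (𝓞 L) = 1 → v.asIdeal.inertiaDegIn (𝓞 L) = 1 →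
          PL.1.IsUnramifiedAbove q →
            IsGaloisCompatibleAt π.1 ι r v

/-- The intended discharge (recorded as a `Prop`, the line's main stub):
Thm. A (existence) + Chebotarev ⟹ `CompatAtSplitOfUnramifyingLift`. -/
def CompatAtSplitOfUnramifyingLift_target : Prop :=
  theoremA_existence → Literature.NumberTheory.Automorphic.chebotarev_artinRep →
    CompatAtSplitOfUnramifyingLift

/-- **The automorphic leaf of card A, abstract form** (Henniart–Kim step: Arthur–Clozel strong
cyclic base change of prime degree along a tower + Grunwald–Wang; output only).  `Good π q v`
is the abstract side condition under which an unramifying lift exists (printed sufficient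
condition: every `π_w`, `w ∣ q`, `w ∉ {v, ᶜv}`, has monodromy-free Langlands parameter, and
`π_{ᶜv}` is unramified).  The statement: for `K` CM, `π` regular algebraic cuspidal unramified
at `v ∣ q`, `Good π q v` ⟹ there is a finite Galois CM extension `L/K` in which `v` splits
completely and a regular algebraic cuspidal strong base change `Π` of `π` unramified above `q`. -/
def UnramifyingSplitLiftExists
    (Good : ∀ {n : ℕ} {K : Type} [Field K] [NumberField K] {hK : isCompact_glFiniteIntegralLevel n K},
      CuspidalAutomorphicRepData n K hK → ℕ → HeightOneSpectrum (𝓞 K) → Prop) : Prop :=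
  ∀ {n : ℕ} {K : Type} [Field K] [NumberField K] (hK : isCompact_glFiniteIntegralLevel n K),
    IsCMField K → ∀ (π : CuspidalAutomorphicRepData n K hK), π.1.IsRegularAlgebraic →
    ∀ (v : HeightOneSpectrum (𝓞 K)) (q : ℕ), q.Prime → ((q : ℕ) : 𝓞 K) ∈ v.asIdeal →
      π.1.IsUnramifiedAt v → Good π q v →
      ∃ (L : Type) (_ : Field L) (_ : NumberField L) (_ : Algebra K L) (_ : IsGalois K L)
        (hL : isCompact_glFiniteIntegralLevel n L) (PL : CuspidalAutomorphicRepData n L hL),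
        IsCMField L ∧ PL.1.IsRegularAlgebraic ∧
        v.asIdeal.ramificationIdxIn (𝓞 L) = 1 ∧ v.asIdeal.inertiaDegIn (𝓞 L) = 1 ∧
        (∀ (w : HeightOneSpectrum (𝓞 L)) (v' : HeightOneSpectrum (𝓞 K)) (α : Multiset ℂ),
          w.asIdeal.under (𝓞 K) = v'.asIdeal → Algebra.IsUnramifiedIn (𝓞 L) v'.asIdeal →
          π.1.HasSatakeParamAt v' α →
            PL.1.HasSatakeParamAt w (α.map (· ^ w.asIdeal.inertiaDeg (𝓞 K)))) ∧
        PL.1.IsUnramifiedAbove q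

/-- **Assembly shape of card A (balanced places)**: from the two leaves, compatibility of the
HLTT representation at every `Good` place — Varma-free. -/
def BalancedCompat
    (Good : ∀ {n : ℕ} {K : Type} [Field K] [NumberField K] {hK : isCompact_glFiniteIntegralLevel n K},
      CuspidalAutomorphicRepData n K hK → ℕ → HeightOneSpectrum (𝓞 K) → Prop) : Prop :=
  ∀ {n : ℕ} {K : Type} [Field K] [NumberField K] (hK : isCompact_glFiniteIntegralLevel n K),
    IsCMField K → ∀ (π : CuspidalAutomorphicRepData n K hK), π.1.IsRegularAlgebraic →
    ∀ (ℓ : ℕ) [Fact ℓ.Prime] (ι : PadicAlgCl ℓ ≃+* ℂ) (r : FramedGaloisRep K (PadicAlgCl ℓ) n),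
      r.toGaloisRep.IsSemisimple → IsCompatible π.1 ι r →
      ∀ (v : HeightOneSpectrum (𝓞 K)) (q : ℕ), q.Prime → q ≠ ℓ → ((q : ℕ) : 𝓞 K) ∈ v.asIdeal →
        π.1.IsUnramifiedAt v → Good π q v → IsGaloisCompatibleAt π.1 ι r v

/-- Pure logic: the two leaves give `BalancedCompat` (the composition the line card will have to
prove; stated, not proved, to keep this sketch check fast). -/
def balancedCompat_of_target
    (Good : ∀ {n : ℕ} {K : Type} [Field K] [NumberField K] {hK : isCompact_glFiniteIntegralLevel n K},
      CuspidalAutomorphicRepData n K hK → ℕ → HeightOneSpectrum (𝓞 K) → Prop) : Prop :=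
  CompatAtSplitOfUnramifyingLift → UnramifyingSplitLiftExists Good → BalancedCompat Good

theorem balancedCompat_of (Good : ∀ {n : ℕ} {K : Type} [Field K] [NumberField K]
      {hK : isCompact_glFiniteIntegralLevel n K},
      CuspidalAutomorphicRepData n K hK → ℕ → HeightOneSpectrum (𝓞 K) → Prop) :
    balancedCompat_of_target Good := by
  intro hC hE n K _ _ hK hCM π hπ ℓ _ ι r hr hc v q hq hqℓ hqv hv hgood
  obtain ⟨L, _, _, _, _, hL, PL, hLCM, hPL, he, hf, hBC, hPLq⟩ := hE hK hCM π hπ v q hq hqv hv hgood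
  exact hC hK hL (Or.inr hLCM) π PL hπ hPL hBC ℓ ι r hr hc v q hq hqℓ hqv he hf hPLq

/-! ## §B. The two limit lemmas of the pseudocharacter seam of Cor. 6.27 -/

/-- **Frobenius characteristic polynomials pass to uniform trace limits** (first lemma of card
`pseudocharacter-seam-627`).  `ρ : Γ_K → GL_n(ℚ̄_ℓ)` unramified at `v`; if for every `m` some
`r'` unramified at `v` has `‖tr r'(g) − tr ρ(g)‖ ≤ ℓ^{-m}` for all `g` and Frobenius polynomial
`P_m` at `v` with `‖coeff_j P_m − coeff_j P‖ ≤ ℓ^{-m}` (`P` monic of degree `n`), then `ρ` has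
Frobenius polynomial `P` at `v`.  Proof idea: `tr ρ(Frob^i) = lim tr r'(Frob^i) = lim pᵢ(P_m) =
pᵢ(P)` for `i = 1..n` (Frobenius powers are Frobenii of nothing, but `tr r'(σ^i)` is the `i`-th
power sum of the roots of `P_m`), and Newton's identities in characteristic `0`
(Mathlib `MvPolynomial.psum_eq_mul_esymm_sub_sum` / `Multiset.esymm`) recover the coefficients. -/
def HasFrobCharpolyAtOfTraceLimit : Prop :=
  ∀ {K : Type} [Field K] [NumberField K] {ℓ : ℕ} [Fact ℓ.Prime] {n : ℕ}
    (v : HeightOneSpectrum (𝓞 K)) (ρ : FramedGaloisRep K (PadicAlgCl ℓ) n) (P : (PadicAlgCl ℓ)[X]),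
    P.Monic → P.natDegree = n → ρ.IsUnramifiedAt v →
    (∀ m : ℕ, ∃ (r' : FramedGaloisRep K (PadicAlgCl ℓ) n) (Pm : (PadicAlgCl ℓ)[X]),
      r'.IsUnramifiedAt v ∧ r'.HasFrobCharpolyAt v Pm ∧
      (∀ g, ‖(r' g).val.trace - (ρ g).val.trace‖ ≤ (ℓ : ℝ) ^ (-(m : ℤ))) ∧
      (∀ j : ℕ, ‖Pm.coeff j - P.coeff j‖ ≤ (ℓ : ℝ) ^ (-(m : ℤ)))) →
    ρ.HasFrobCharpolyAt v P

/-- **A semisimple representation whose trace is a uniform limit of traces unramified at `v` is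
unramified at `v`** — the semisimple generalisation of the tree's
`FramedGaloisRep.isUnramifiedAt_of_trace_limit` (irreducible case, Burnside).  Proof idea: the
identity `tr ρ(gσ) = tr ρ(g)` (`σ` inertial) passes to the limit; on the semisimple image algebra
`𝒜 = ρ(ℚ̄_ℓ[Γ_K]) ≅ ⊕ M_{dᵢ}` the trace form `(A, B) ↦ tr_V(AB) = ∑ mᵢ tr(AᵢBᵢ)` is
non-degenerate in characteristic `0`, and `ρ(σ) − 1 ∈ 𝒜`, so `ρ(σ) = 1`. -/
def IsUnramifiedAtOfTraceLimitSemisimple : Prop :=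
  ∀ {K : Type} [Field K] [NumberField K] {ℓ : ℕ} [Fact ℓ.Prime] {n : ℕ}
    (v : HeightOneSpectrum (𝓞 K)) (ρ : FramedGaloisRep K (PadicAlgCl ℓ) n),
    ρ.toGaloisRep.IsSemisimple →
    (∀ m : ℕ, ∃ r' : FramedGaloisRep K (PadicAlgCl ℓ) n,
      r'.IsUnramifiedAt v ∧ ∀ g, ‖(r' g).val.trace - (ρ g).val.trace‖ ≤ (ℓ : ℝ) ^ (-(m : ℤ))) →
    ρ.IsUnramifiedAt v

/-- Sanity: the tree's irreducible case is an instance of the vocabulary used above. -/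
example {K : Type} [Field K] [NumberField K] {ℓ : ℕ} [Fact ℓ.Prime] {n : ℕ}
    (v : HeightOneSpectrum (𝓞 K)) (ρ : FramedGaloisRep K (PadicAlgCl ℓ) n)
    (hirr : ρ.toGaloisRep.IsIrreducible)
    (h : ∀ m : ℕ, ∃ r' : FramedGaloisRep K (PadicAlgCl ℓ) n,
      r'.IsUnramifiedAt v ∧ ∀ g, ‖(r' g).val.trace - (ρ g).val.trace‖ ≤ (ℓ : ℝ) ^ (-(m : ℤ))) :
    ρ.IsUnramifiedAt v :=
  FramedGaloisRep.isUnramifiedAt_of_trace_limit v ρ hirr h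

end Summit.Langlands.Langlands.Cruxes.GaloisRepOfRegularAlgebraic.Sketch

end
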